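import Literature.NumberTheory.ModularSymbols.FullLevelHomologyHeckeRepsDown
import HarnessLib

/-!
# Hecke compatibility of the up/down dictionary: `torusInvariantsToCuspidal ∘ T_q^{up} = T_q^{down} ∘ torusInvariantsToCuspidal`

Topic `Literature/NumberTheory/ModularSymbols`; namespace `Literature.NumberTheory.ModularSymbols.FullLevel`; conclusion of the
chain `FullLevelHomologyCarrier → TorusLevel → CuspidalClass → HeckeChain/Equivariant → CosetClasses → HeckeTransfer →
HeckeRepsDown` (route BSD/TeichmullerTwistDescent, K-line step (S2), memo CARRIER-gen1 §6 (3)).  Proved theorems only; no named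
fact, no `sorry`.

* **`sum_symbol_transferHecke`**: `Σᵢ ({∞,(δ⁻¹tᵢδ)∞} ⊗ 1) = T_q({∞,(δ⁻¹γδ)∞} ⊗ 1)` in `H(p²M; k)` for `γ ∈ Γ_T` — the instance of
  `CuspidalHomologyHeckeRepIndependence.sum_symbol_eq_heckeOp_of_reps` with representatives `Bᵢ = gᵢβ_{e(i)}`, `e = idxDownEquiv`,
  `τ = σ_γ`, and the coset relation `conjDown_transferHecke_mul_repDown`.
* **`heckeComparison_baseCycle`** and **`heckeComparison`**: for every `z ∈ H₁(Γ₀(M), k[GL₂(ℤ/p)])^{T̃}`,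
  `torusInvariantsToCuspidal (T_q z) = heckeOp (p²M) k q (torusInvariantsToCuspidal z)` (`q ≠ p` prime, `gcd(p,M) = 1`,
  `|T̃| ∈ kˣ`): the up/down dictionary `H₁(Y(K(p)K₀(M)), k)^{T̃} ↠ H₁(X₀(p²M), k)` is HECKE-EQUIVARIANT away from `p`
  (base coset classes `cosetClass [γ ⊗ aδ_{T̃}]`, which exhaust the invariants through the Shapiro/averaging equivalence,
  `torusInvariantsEquiv_symm_single`).

Consequence for the K-line (not formalised here): eigen-ideals `𝔪`, `𝔭_W` of the prime-to-`pM` Hecke algebra defined UPSTAIRS with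
`heckeT` cut out, under the dictionary and the period maps, exactly the `f_W`-parts downstairs (audit (S2)–(S3)).  Nothing about
any elliptic curve is asserted.

## References
* G. Shimura, *Introduction to the arithmetic theory of automorphic functions* (1971), §3.1, §8.3 (8.3.2). [Shimura1971]
* A. Ash, G. Stevens, Duke Math. J. 53 (1986), §1 (1.2)–(1.4). [AshStevens1986]
* A. W. Knapp, *Elliptic Curves* (1993), Prop. 11.23. [Knapp1993]
* K. S. Brown, *Cohomology of Groups* (1982), Ch. III §6 Prop. 6.2. [Brown1982]
-/

noncomputable section

namespace Literature.NumberTheory.ModularSymbols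

namespace FullLevel

open scoped MatrixGroups TensorProduct
open CategoryTheory CongruenceSubgroup groupHomology Finsupp Matrix
open Literature.Algebra.Homology
open Literature.NumberTheory.EllipticCurves.ModularForms

variable (p M : ℕ) [Fact p.Prime] (hpM : Nat.Coprime p M) {q : ℕ} (hq : q.Prime) (hqp : q ≠ p) [NeZero q]

/-! ### The downstairs identity and the comparison on base coset classes -/

/-- **Downstairs**: `Σᵢ {∞,(δ⁻¹tᵢδ)∞} ⊗ 1 = T_q ({∞,(δ⁻¹γδ)∞} ⊗ 1)` in `H(p²M; k)` (representative independence with the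
representatives `Bᵢ = gᵢ β_{e(i)}`). [cite: Shimura1971, §3.1 and §8.3 (8.3.2); Knapp1993, Prop. 11.23] -/
theorem sum_symbol_transferHecke (k : Type) [CommRing k] [NeZero (p ^ 2 * M)] (γ : torusLevel p M) :
    ∑ i : HeckeIdx M q, Literature.NumberTheory.ModularSymbols.symbol (p ^ 2 * M) k
        (torusLevelEquiv p M hpM ⟨transferHecke p M hpM hq hqp γ.1 i, transferHecke_mem p M hpM hq hqp γ.2 i⟩ : Gamma0 (p ^ 2 * M)) =
      heckeOp (p ^ 2 * M) k q hq (Literature.NumberTheory.ModularSymbols.symbol (p ^ 2 * M) k (torusLevelEquiv p M hpM γ : Gamma0 (p ^ 2 * M))) := by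
  refine sum_symbol_eq_heckeOp_of_reps (p ^ 2 * M) hq k (idxDownEquiv p M hpM hq hqp) (gDown p M hpM hq hqp)
    (torusLevelEquiv p M hpM γ) _ (heckePermEquiv hq γ.1) (fun i => ?_)
  show conjDown p (HidaCohomology.gmat (transferHecke p M hpM hq hqp γ.1 i)) *
      (HidaCohomology.gmat (gDown p M hpM hq hqp (heckePerm hq γ.1 i)) * heckeRep q (idxDown p M hpM hq hqp (heckePerm hq γ.1 i)).1) =
    (HidaCohomology.gmat (gDown p M hpM hq hqp i) * heckeRep q (idxDown p M hpM hq hqp i).1) * conjDown p (HidaCohomology.gmat γ.1)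
  rw [gDown_mul, gDown_mul]
  exact conjDown_transferHecke_mul_repDown p M hpM hq hqp γ i

/-! ### The comparison theorem -/

variable (k : Type) [CommRing k] [Fintype (diagTorus (ZMod p))] [Invertible (Fintype.card (diagTorus (ZMod p)) : k)]
  [NeZero M] [NeZero (p ^ 2 * M)]

/-- **Hecke comparison on base coset classes**: for `γ ∈ Γ_T`,
`(up/down dictionary ∘ T_q^{up})(cosetClass [γ ⊗ aδ_{T̃}]) = T_q^{down}((up/down dictionary)(cosetClass [γ ⊗ aδ_{T̃}]))`.
[cite: Shimura1971, §8.3 (8.3.2); AshStevens1986, §1 (1.4)] -/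
theorem heckeComparison_baseCycle (γ : torusLevel p M) (a : k) :
    torusInvariantsToCuspidal k p M hpM
        (heckeTInvariants k p M hq hqp (diagTorus (ZMod p)) (cosetClass k p M (baseCycle k p M γ a))) =
      heckeOp (p ^ 2 * M) k q hq (torusInvariantsToCuspidal k p M hpM (cosetClass k p M (baseCycle k p M γ a))) := by
  rw [heckeTInvariants_cosetClass_baseCycle, torusInvariantsToCuspidal_cosetClass_heckeCycle,
    torusInvariantsToCuspidal_cosetClass_baseCycle, ← Finset.smul_sum, sum_symbol_transferHecke p M hpM hq hqp k γ, map_smul]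

omit [NeZero M] [NeZero (p ^ 2 * M)] in
/-- Base coset classes exhaust the torus invariants through the dictionary: the inverse dictionary of `[γ ⊗ a]` is
`cosetClass [γ ⊗ aδ_{T̃}]`. [cite: Brown1982, Ch. III §6 Prop. 6.2] -/
theorem torusInvariantsEquiv_symm_single (γ : torusLevel p M) (a : k) :
    (torusInvariantsEquiv k p M hpM).symm
        (H1π (Rep.trivial k (torusLevel p M) k) ((cycles₁IsoOfIsTrivial (Rep.trivial k (torusLevel p M) k)).inv (single γ a))) =
      cosetClass k p M (baseCycle k p M γ a) :=
  (LinearEquiv.symm_apply_eq _).2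
    (torusInvariantsEquiv_cosetClass_of_eq k p M hpM _ _ (componentMap_single_eq_baseCycle k p M γ a)).symm

/-- **HECKE COMPATIBILITY OF THE UP/DOWN DICTIONARY.**  For `q ∤ pM`... (`q ≠ p` prime, `gcd(p, M) = 1`, `|T̃| ∈ kˣ`):
`torusInvariantsToCuspidal ∘ T_q^{up} = T_q^{down} ∘ torusInvariantsToCuspidal` on `H₁(Γ₀(M), k[GL₂(ℤ/p)])^{T̃}`, where
`T_q^{up} = heckeTInvariants` (the Hecke operator of the full-level carrier) and `T_q^{down} = heckeOp (p²M) k q` (the tree's Hecke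
operator on `H(p²M; k) = H₁(X₀(p²M), k)`).  This is step (S2) of the K-line of route BSD/TeichmullerTwistDescent made
Hecke-equivariant: eigen-parts upstairs map to eigen-parts downstairs. [cite: AshStevens1986, §1 (1.2)–(1.4); Shimura1971, §8.3] -/
theorem heckeComparison (z : PermutationCoeff.H1Invariants k (redGL p M) (diagTorus (ZMod p))) :
    torusInvariantsToCuspidal k p M hpM (heckeTInvariants k p M hq hqp (diagTorus (ZMod p)) z) =
      heckeOp (p ^ 2 * M) k q hq (torusInvariantsToCuspidal k p M hpM z) := by
  obtain ⟨w, rfl⟩ : ∃ w, (torusInvariantsEquiv k p M hpM).symm w = z :=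
    ⟨torusInvariantsEquiv k p M hpM z, LinearEquiv.symm_apply_apply _ _⟩
  induction w using H1_induction_on with
  | h x =>
    have hx : x = (cycles₁IsoOfIsTrivial (Rep.trivial k (torusLevel p M) k)).inv x.1 :=
      Subtype.ext (cycles₁IsoOfIsTrivial_inv_apply _).symm
    rw [hx]
    generalize x.1 = f
    induction f using Finsupp.induction_linear with
    | zero => simp
    | add f₁ f₂ h₁ h₂ => simp only [map_add, h₁, h₂]
    | single γ a => rw [torusInvariantsEquiv_symm_single]; exact heckeComparison_baseCycle p M hpM hq hqp k γ a

end FullLevel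

end Literature.NumberTheory.ModularSymbols
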